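import Literature.NumberTheory.Sieve.DrappeauDispersionR1ppReindex
import HarnessLib

/-!
# Drappeau 2017, §5.5: the concrete weights of the pieces versus the five-variable weight `g`

Topic `Literature/NumberTheory/Sieve`, part of the formalisation of §5 of S. Drappeau, Proc. London
Math. Soc. (3) 114 (2017) 684–732 = arXiv:1504.05549, p. 20–21.  The two-variable weight of a
piece, `G_{ij}(q₁,q₂) = piece_i(q₁) piece_j(q₂) α(κq₁q₂)`, agrees at `(q₁,q₂) = (δ₁𝐝, δ₂𝐜)` with
the five-variable weight `g = drWeight (piece_j ∘ (q₀δ₂·)) (piece_i ∘ (q₀δ₁·)) (κδ₁δ₂) 2^k R S'`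
of Theorem 2.1 on the plateau `2^k ≤ 𝐧 < 2^{k+1}`, `R < 𝐫 ≤ 2R`, `S' < 𝐬 ≤ 2S'`
(`R = |a₂|δ₁N`, `S' = δ₂N/n₀`); the support of `g` controls the ranges; `G` is real.  Everything
proved (no definition, no named fact); one statement per pair `(i,j) ∈ {Lo,Hi}²`.

* `plateau_eq_one`, `conj_pieceLo`, `conj_pieceHi`, `conj_alphaProfile`,
  `gammaDil_ne_zero_of_pieceLo/Hi`;
* `G_eq_drWeight_XY`, `drWeight_support_XY`, `conj_G_XY` for `XY ∈ {LL, LH, HL, HH}`.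

## References

* S. Drappeau, Proc. London Math. Soc. (3) 114 (2017) 684–732, arXiv:1504.05549, §5.5 p. 20–21.
  [cite: Drappeau2017, §5.5]
-/

noncomputable section

open Finset Real Complex
open scoped ArithmeticFunction.Moebius FourierTransform

namespace Literature.NumberTheory.Sieve

namespace Drappeau2017

open KloostermanQuintilinear

/-- The cut-off is `1` on `[M, 2M]` (`M > 0`). [folklore] -/
theorem plateau_eq_one {M t : ℝ} (hM : 0 < M) (h1 : M ≤ t) (h2 : t ≤ 2 * M) : plateau M t = 1 := by
  unfold plateau; rw [BFI.bumpC_apply, BFI.bump_eq_one (by positivity) h1 h2]; simp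

/-- [folklore] -/
theorem conj_gammaDil (S Y q₀ t : ℝ) : starRingEnd ℂ (gammaDil S Y q₀ t) = gammaDil S Y q₀ t := by
  unfold gammaDil; rw [BFI.bumpC_apply, Complex.conj_ofReal]

/-- [folklore] -/
theorem conj_splitDil (S q₀ t : ℝ) : starRingEnd ℂ (splitDil S q₀ t) = splitDil S q₀ t := by
  unfold splitDil; rw [BFI.bumpC_apply, Complex.conj_ofReal]

/-- [folklore] -/
theorem conj_pieceLo (S Y q₀ t : ℝ) : starRingEnd ℂ (pieceLo S Y q₀ t) = pieceLo S Y q₀ t := by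
  unfold pieceLo; rw [map_mul, conj_gammaDil, conj_splitDil]

/-- [folklore] -/
theorem conj_pieceHi (S Y q₀ t : ℝ) : starRingEnd ℂ (pieceHi S Y q₀ t) = pieceHi S Y q₀ t := by
  unfold pieceHi; rw [map_sub, conj_gammaDil, conj_pieceLo]

/-- [folklore] -/
theorem conj_alphaProfile (t : ℝ) : starRingEnd ℂ (alphaProfile t) = alphaProfile t := by
  unfold alphaProfile; rw [BFI.bumpC_apply, Complex.conj_ofReal]

/-- [folklore] -/
theorem gammaDil_ne_zero_of_pieceLo {S Y q₀ t : ℝ} (h : pieceLo S Y q₀ t ≠ 0) : gammaDil S Y q₀ t ≠ 0 := by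
  unfold pieceLo at h; exact left_ne_zero_of_mul h

/-- [folklore] -/
theorem gammaDil_ne_zero_of_pieceHi {S Y q₀ t : ℝ} (h : pieceHi S Y q₀ t ≠ 0) : gammaDil S Y q₀ t ≠ 0 := by
  intro h0
  apply h
  unfold pieceHi pieceLo
  rw [h0, zero_mul, sub_zero]

/-- `γ((q₀δ)c) ≠ 0 ⟹ q₀(δc) ∈ mRange S Y`. [folklore] -/
theorem mem_mRange_of_gammaDil_ne_zero {S Y : ℝ} (hY : 0 < Y) (hS : 0 ≤ S) {q₀ δ c : ℕ}
    (h : gammaDil S Y ((q₀ : ℝ) * δ) c ≠ 0) : q₀ * (δ * c) ∈ BFI.mRange S Y := by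
  unfold gammaDil at h
  rw [BFI.bumpC_apply] at h
  have e : ((q₀ * (δ * c) : ℕ) : ℝ) = (q₀ : ℝ) * δ * c := by push_cast; ring
  have h' : BFI.bump S Y ((q₀ * (δ * c) : ℕ) : ℝ) ≠ 0 := by
    rw [e]; intro h0; apply h; rw [h0]; simp
  exact BFI.mem_mRange_of_bump_ne_zero hY hS h'


/-- **`G_{XY}(δ₁𝐝, δ₂𝐜) = g_{XY}(𝐜,𝐝,𝐧,𝐫,𝐬)` on the plateau.** [cite: Drappeau2017, §5.5 p. 20–21] -/
theorem G_eq_drWeight_LL {S Y ξ M N : ℝ} (hN : 0 < N) {a₁ a₂ : ℤ} (ha₂ : a₂ ≠ 0) {q₀ n₀ δ₁ δ₂ : ℕ}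
    (hn₀ : 0 < n₀) (hδ₁ : 0 < δ₁) (hδ₂ : 0 < δ₂) (σ : ℤ) {c d n₁ n₂ : ℕ}
    (hn₁ : n₀ * n₁ ∈ BFI.dyadic N) (hn₂ : n₀ * n₂ ∈ BFI.dyadic N) (h : ℤ) {k : ℕ}
    (hlo : (((2 ^ k : ℕ) : ℕ) : ℤ) ≤ nVar σ a₁ a₂ q₀ h n₁ n₂)
    (hhi : nVar σ a₁ a₂ q₀ h n₁ n₂ < (((2 ^ (k + 1) : ℕ) : ℕ) : ℤ)) :
    (fun q₁ q₂ : ℕ => pieceLo S Y q₀ q₁ * pieceLo S Y q₀ q₂ *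
          alphaProfile ((q₀ : ℝ) * ξ / M * q₁ * q₂)) (δ₁ * d) (δ₂ * c) =
      (drWeight (pieceLo S Y ((q₀ : ℝ) * δ₂)) (pieceLo S Y ((q₀ : ℝ) * δ₁))
          ((q₀ : ℝ) * ξ / M * δ₁ * δ₂) ((2 : ℝ) ^ k) ((a₂.natAbs : ℝ) * δ₁ * N) ((δ₂ : ℝ) * N / n₀)) c d (nVar σ a₁ a₂ q₀ h n₁ n₂).toNat ((a₂.natAbs * n₀ * δ₁ * n₂ : ℕ) : ℝ) ((δ₂ * n₁ : ℕ) : ℝ) := by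
  beta_reduce
  unfold drWeight
  -- the plateaus are `1`
  have h0 : 0 ≤ nVar σ a₁ a₂ q₀ h n₁ n₂ := le_trans (by positivity) hlo
  have hNc : (((nVar σ a₁ a₂ q₀ h n₁ n₂).toNat : ℕ) : ℝ) = ((nVar σ a₁ a₂ q₀ h n₁ n₂ : ℤ) : ℝ) := by
    rw [show (((nVar σ a₁ a₂ q₀ h n₁ n₂).toNat : ℕ) : ℝ) =
      (((nVar σ a₁ a₂ q₀ h n₁ n₂).toNat : ℤ) : ℝ) by norm_cast, Int.toNat_of_nonneg h0]
  have hp1 : plateau ((2 : ℝ) ^ k) (((nVar σ a₁ a₂ q₀ h n₁ n₂).toNat : ℕ) : ℝ) = 1 := by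
    rw [hNc]
    refine plateau_eq_one (by positivity) ?_ ?_
    · have : ((2 : ℤ) ^ k : ℤ) ≤ nVar σ a₁ a₂ q₀ h n₁ n₂ := by exact_mod_cast hlo
      exact_mod_cast this
    · have : nVar σ a₁ a₂ q₀ h n₁ n₂ ≤ 2 * (2 : ℤ) ^ k := by
        have := hhi; push_cast at this; rw [pow_succ] at this; linarith
      exact_mod_cast this
  have hNr := (BFI.mem_dyadic hN.le).1 hn₁
  have hNr2 := (BFI.mem_dyadic hN.le).1 hn₂
  push_cast at hNr hNr2
  have har : (0 : ℝ) < a₂.natAbs := by exact_mod_cast Int.natAbs_pos.2 ha₂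
  have hδ₁r : (0 : ℝ) < δ₁ := by exact_mod_cast hδ₁
  have hδ₂r : (0 : ℝ) < δ₂ := by exact_mod_cast hδ₂
  have hn₀r : (0 : ℝ) < n₀ := by exact_mod_cast hn₀
  have hp2 : plateau ((a₂.natAbs : ℝ) * δ₁ * N) ((a₂.natAbs * n₀ * δ₁ * n₂ : ℕ) : ℝ) = 1 := by
    refine plateau_eq_one (by positivity) ?_ ?_
    · push_cast; nlinarith [mul_pos har hδ₁r, hNr2.1]
    · push_cast; nlinarith [mul_pos har hδ₁r, hNr2.2]
  have hp3 : plateau ((δ₂ : ℝ) * N / n₀) ((δ₂ * n₁ : ℕ) : ℝ) = 1 := by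
    refine plateau_eq_one (by positivity) ?_ ?_
    · push_cast; rw [div_le_iff₀ hn₀r]; nlinarith [hNr.1]
    · push_cast; rw [show 2 * ((δ₂ : ℝ) * N / n₀) = 2 * ((δ₂ : ℝ) * N) / n₀ by ring, le_div_iff₀ hn₀r]
      nlinarith [hNr.2]
  rw [hp1, hp2, hp3, mul_one, mul_one, mul_one]
  push_cast
  rw [pieceLo_mul_arg, pieceLo_mul_arg]
  rw [show (q₀ : ℝ) * ξ / M * δ₁ * δ₂ * c * d = (q₀ : ℝ) * ξ / M * ((δ₁ : ℝ) * d) * ((δ₂ : ℝ) * c) by ring]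
  ring

/-- **Support of `g_{XY}`**: ranges of `𝐜, 𝐝` and membership of the moduli in `mRange`.
[cite: Drappeau2017, §5.5 p. 20–21] -/
theorem drWeight_support_LL {S Y ξ M N : ℝ} (hY : 0 < Y) (hYS : Y ≤ S / 4) (hN : 0 < N)
    {a₂ : ℤ} (ha₂ : a₂ ≠ 0) {q₀ n₀ δ₁ δ₂ : ℕ} (hq₀ : 0 < q₀) (hn₀ : 0 < n₀) (hδ₁ : 0 < δ₁)
    (hδ₂ : 0 < δ₂) (k : ℕ) (c d : ℕ) (n r s : ℝ)
    (h : (drWeight (pieceLo S Y ((q₀ : ℝ) * δ₂)) (pieceLo S Y ((q₀ : ℝ) * δ₁))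
          ((q₀ : ℝ) * ξ / M * δ₁ * δ₂) ((2 : ℝ) ^ k) ((a₂.natAbs : ℝ) * δ₁ * N) ((δ₂ : ℝ) * N / n₀)) c d n r s ≠ 0) :
    (1 ≤ c ∧ c ≤ ⌊2 * (29 / 40 * S / ((q₀ : ℝ) * δ₂))⌋₊ ∧ 1 ≤ d ∧ d ≤ ⌊2 * (29 / 40 * S / ((q₀ : ℝ) * δ₁))⌋₊) ∧
      q₀ * (δ₂ * c) ∈ BFI.mRange S Y ∧ q₀ * (δ₁ * d) ∈ BFI.mRange S Y := by
  have hS : 0 < S := by linarith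
  have hq₀r : (0 : ℝ) < q₀ := by exact_mod_cast hq₀
  have hδ₁r : (0 : ℝ) < δ₁ := by exact_mod_cast hδ₁
  have hδ₂r : (0 : ℝ) < δ₂ := by exact_mod_cast hδ₂
  have har : (0 : ℝ) < a₂.natAbs := by exact_mod_cast Int.natAbs_pos.2 ha₂
  have hn₀r : (0 : ℝ) < n₀ := by exact_mod_cast hn₀
  have hsupp := drWeight_ne_zero (fun t ht => pieceLo_ne_zero hY hYS (by positivity) ht)
    (fun t ht => pieceLo_ne_zero hY hYS (by positivity) ht) ((q₀ : ℝ) * ξ / M * δ₁ * δ₂)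
    (Mn := (2 : ℝ) ^ k) (R := (a₂.natAbs : ℝ) * δ₁ * N) (S' := (δ₂ : ℝ) * N / n₀)
    (by positivity) (by positivity) (by positivity) h
  obtain ⟨hc1, hc2, hd1, hd2, -, -, -⟩ := hsupp
  -- the first two factors do not vanish
  unfold drWeight at h
  have hA := left_ne_zero_of_mul (left_ne_zero_of_mul (left_ne_zero_of_mul
    (left_ne_zero_of_mul (left_ne_zero_of_mul h))))
  have hB := right_ne_zero_of_mul (left_ne_zero_of_mul (left_ne_zero_of_mul
    (left_ne_zero_of_mul (left_ne_zero_of_mul h))))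
  have hCpos : 0 < (29 / 40 * S / ((q₀ : ℝ) * δ₂)) := by positivity
  have hDpos : 0 < (29 / 40 * S / ((q₀ : ℝ) * δ₁)) := by positivity
  refine ⟨⟨?_, Nat.le_floor hc2, ?_, Nat.le_floor hd2⟩,
    mem_mRange_of_gammaDil_ne_zero hY hS.le (gammaDil_ne_zero_of_pieceLo hA),
    mem_mRange_of_gammaDil_ne_zero hY hS.le (gammaDil_ne_zero_of_pieceLo hB)⟩
  · have : (0 : ℝ) < c := hCpos.trans hc1
    exact Nat.one_le_iff_ne_zero.2 fun h0 => by rw [h0] at this; simp at this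
  · have : (0 : ℝ) < d := hDpos.trans hd1
    exact Nat.one_le_iff_ne_zero.2 fun h0 => by rw [h0] at this; simp at this

/-- **`G_{XY}` is real.** [folklore] -/
theorem conj_G_LL (S Y ξ M : ℝ) (q₀ : ℕ) (q₁ q₂ : ℕ) :
    starRingEnd ℂ ((fun q₁ q₂ : ℕ => pieceLo S Y q₀ q₁ * pieceLo S Y q₀ q₂ *
          alphaProfile ((q₀ : ℝ) * ξ / M * q₁ * q₂)) q₁ q₂) = (fun q₁ q₂ : ℕ => pieceLo S Y q₀ q₁ * pieceLo S Y q₀ q₂ *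
          alphaProfile ((q₀ : ℝ) * ξ / M * q₁ * q₂)) q₁ q₂ := by
  beta_reduce
  rw [map_mul, map_mul, conj_pieceLo, conj_pieceLo, conj_alphaProfile]

/-- **`G_{XY}(δ₁𝐝, δ₂𝐜) = g_{XY}(𝐜,𝐝,𝐧,𝐫,𝐬)` on the plateau.** [cite: Drappeau2017, §5.5 p. 20–21] -/
theorem G_eq_drWeight_LH {S Y ξ M N : ℝ} (hN : 0 < N) {a₁ a₂ : ℤ} (ha₂ : a₂ ≠ 0) {q₀ n₀ δ₁ δ₂ : ℕ}
    (hn₀ : 0 < n₀) (hδ₁ : 0 < δ₁) (hδ₂ : 0 < δ₂) (σ : ℤ) {c d n₁ n₂ : ℕ}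
    (hn₁ : n₀ * n₁ ∈ BFI.dyadic N) (hn₂ : n₀ * n₂ ∈ BFI.dyadic N) (h : ℤ) {k : ℕ}
    (hlo : (((2 ^ k : ℕ) : ℕ) : ℤ) ≤ nVar σ a₁ a₂ q₀ h n₁ n₂)
    (hhi : nVar σ a₁ a₂ q₀ h n₁ n₂ < (((2 ^ (k + 1) : ℕ) : ℕ) : ℤ)) :
    (fun q₁ q₂ : ℕ => pieceLo S Y q₀ q₁ * pieceHi S Y q₀ q₂ *
          alphaProfile ((q₀ : ℝ) * ξ / M * q₁ * q₂)) (δ₁ * d) (δ₂ * c) =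
      (drWeight (pieceHi S Y ((q₀ : ℝ) * δ₂)) (pieceLo S Y ((q₀ : ℝ) * δ₁))
          ((q₀ : ℝ) * ξ / M * δ₁ * δ₂) ((2 : ℝ) ^ k) ((a₂.natAbs : ℝ) * δ₁ * N) ((δ₂ : ℝ) * N / n₀)) c d (nVar σ a₁ a₂ q₀ h n₁ n₂).toNat ((a₂.natAbs * n₀ * δ₁ * n₂ : ℕ) : ℝ) ((δ₂ * n₁ : ℕ) : ℝ) := by
  beta_reduce
  unfold drWeight
  -- the plateaus are `1`
  have h0 : 0 ≤ nVar σ a₁ a₂ q₀ h n₁ n₂ := le_trans (by positivity) hlo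
  have hNc : (((nVar σ a₁ a₂ q₀ h n₁ n₂).toNat : ℕ) : ℝ) = ((nVar σ a₁ a₂ q₀ h n₁ n₂ : ℤ) : ℝ) := by
    rw [show (((nVar σ a₁ a₂ q₀ h n₁ n₂).toNat : ℕ) : ℝ) =
      (((nVar σ a₁ a₂ q₀ h n₁ n₂).toNat : ℤ) : ℝ) by norm_cast, Int.toNat_of_nonneg h0]
  have hp1 : plateau ((2 : ℝ) ^ k) (((nVar σ a₁ a₂ q₀ h n₁ n₂).toNat : ℕ) : ℝ) = 1 := by
    rw [hNc]
    refine plateau_eq_one (by positivity) ?_ ?_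
    · have : ((2 : ℤ) ^ k : ℤ) ≤ nVar σ a₁ a₂ q₀ h n₁ n₂ := by exact_mod_cast hlo
      exact_mod_cast this
    · have : nVar σ a₁ a₂ q₀ h n₁ n₂ ≤ 2 * (2 : ℤ) ^ k := by
        have := hhi; push_cast at this; rw [pow_succ] at this; linarith
      exact_mod_cast this
  have hNr := (BFI.mem_dyadic hN.le).1 hn₁
  have hNr2 := (BFI.mem_dyadic hN.le).1 hn₂
  push_cast at hNr hNr2
  have har : (0 : ℝ) < a₂.natAbs := by exact_mod_cast Int.natAbs_pos.2 ha₂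
  have hδ₁r : (0 : ℝ) < δ₁ := by exact_mod_cast hδ₁
  have hδ₂r : (0 : ℝ) < δ₂ := by exact_mod_cast hδ₂
  have hn₀r : (0 : ℝ) < n₀ := by exact_mod_cast hn₀
  have hp2 : plateau ((a₂.natAbs : ℝ) * δ₁ * N) ((a₂.natAbs * n₀ * δ₁ * n₂ : ℕ) : ℝ) = 1 := by
    refine plateau_eq_one (by positivity) ?_ ?_
    · push_cast; nlinarith [mul_pos har hδ₁r, hNr2.1]
    · push_cast; nlinarith [mul_pos har hδ₁r, hNr2.2]
  have hp3 : plateau ((δ₂ : ℝ) * N / n₀) ((δ₂ * n₁ : ℕ) : ℝ) = 1 := by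
    refine plateau_eq_one (by positivity) ?_ ?_
    · push_cast; rw [div_le_iff₀ hn₀r]; nlinarith [hNr.1]
    · push_cast; rw [show 2 * ((δ₂ : ℝ) * N / n₀) = 2 * ((δ₂ : ℝ) * N) / n₀ by ring, le_div_iff₀ hn₀r]
      nlinarith [hNr.2]
  rw [hp1, hp2, hp3, mul_one, mul_one, mul_one]
  push_cast
  rw [pieceLo_mul_arg, pieceHi_mul_arg]
  rw [show (q₀ : ℝ) * ξ / M * δ₁ * δ₂ * c * d = (q₀ : ℝ) * ξ / M * ((δ₁ : ℝ) * d) * ((δ₂ : ℝ) * c) by ring]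
  ring

/-- **Support of `g_{XY}`**: ranges of `𝐜, 𝐝` and membership of the moduli in `mRange`.
[cite: Drappeau2017, §5.5 p. 20–21] -/
theorem drWeight_support_LH {S Y ξ M N : ℝ} (hY : 0 < Y) (hYS : Y ≤ S / 4) (hN : 0 < N)
    {a₂ : ℤ} (ha₂ : a₂ ≠ 0) {q₀ n₀ δ₁ δ₂ : ℕ} (hq₀ : 0 < q₀) (hn₀ : 0 < n₀) (hδ₁ : 0 < δ₁)
    (hδ₂ : 0 < δ₂) (k : ℕ) (c d : ℕ) (n r s : ℝ)
    (h : (drWeight (pieceHi S Y ((q₀ : ℝ) * δ₂)) (pieceLo S Y ((q₀ : ℝ) * δ₁))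
          ((q₀ : ℝ) * ξ / M * δ₁ * δ₂) ((2 : ℝ) ^ k) ((a₂.natAbs : ℝ) * δ₁ * N) ((δ₂ : ℝ) * N / n₀)) c d n r s ≠ 0) :
    (1 ≤ c ∧ c ≤ ⌊2 * (9 / 8 * S / ((q₀ : ℝ) * δ₂))⌋₊ ∧ 1 ≤ d ∧ d ≤ ⌊2 * (29 / 40 * S / ((q₀ : ℝ) * δ₁))⌋₊) ∧
      q₀ * (δ₂ * c) ∈ BFI.mRange S Y ∧ q₀ * (δ₁ * d) ∈ BFI.mRange S Y := by
  have hS : 0 < S := by linarith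
  have hq₀r : (0 : ℝ) < q₀ := by exact_mod_cast hq₀
  have hδ₁r : (0 : ℝ) < δ₁ := by exact_mod_cast hδ₁
  have hδ₂r : (0 : ℝ) < δ₂ := by exact_mod_cast hδ₂
  have har : (0 : ℝ) < a₂.natAbs := by exact_mod_cast Int.natAbs_pos.2 ha₂
  have hn₀r : (0 : ℝ) < n₀ := by exact_mod_cast hn₀
  have hsupp := drWeight_ne_zero (fun t ht => pieceHi_ne_zero hY hYS (by positivity) ht)
    (fun t ht => pieceLo_ne_zero hY hYS (by positivity) ht) ((q₀ : ℝ) * ξ / M * δ₁ * δ₂)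
    (Mn := (2 : ℝ) ^ k) (R := (a₂.natAbs : ℝ) * δ₁ * N) (S' := (δ₂ : ℝ) * N / n₀)
    (by positivity) (by positivity) (by positivity) h
  obtain ⟨hc1, hc2, hd1, hd2, -, -, -⟩ := hsupp
  -- the first two factors do not vanish
  unfold drWeight at h
  have hA := left_ne_zero_of_mul (left_ne_zero_of_mul (left_ne_zero_of_mul
    (left_ne_zero_of_mul (left_ne_zero_of_mul h))))
  have hB := right_ne_zero_of_mul (left_ne_zero_of_mul (left_ne_zero_of_mul
    (left_ne_zero_of_mul (left_ne_zero_of_mul h))))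
  have hCpos : 0 < (9 / 8 * S / ((q₀ : ℝ) * δ₂)) := by positivity
  have hDpos : 0 < (29 / 40 * S / ((q₀ : ℝ) * δ₁)) := by positivity
  refine ⟨⟨?_, Nat.le_floor hc2, ?_, Nat.le_floor hd2⟩,
    mem_mRange_of_gammaDil_ne_zero hY hS.le (gammaDil_ne_zero_of_pieceHi hA),
    mem_mRange_of_gammaDil_ne_zero hY hS.le (gammaDil_ne_zero_of_pieceLo hB)⟩
  · have : (0 : ℝ) < c := hCpos.trans hc1
    exact Nat.one_le_iff_ne_zero.2 fun h0 => by rw [h0] at this; simp at this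
  · have : (0 : ℝ) < d := hDpos.trans hd1
    exact Nat.one_le_iff_ne_zero.2 fun h0 => by rw [h0] at this; simp at this

/-- **`G_{XY}` is real.** [folklore] -/
theorem conj_G_LH (S Y ξ M : ℝ) (q₀ : ℕ) (q₁ q₂ : ℕ) :
    starRingEnd ℂ ((fun q₁ q₂ : ℕ => pieceLo S Y q₀ q₁ * pieceHi S Y q₀ q₂ *
          alphaProfile ((q₀ : ℝ) * ξ / M * q₁ * q₂)) q₁ q₂) = (fun q₁ q₂ : ℕ => pieceLo S Y q₀ q₁ * pieceHi S Y q₀ q₂ *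
          alphaProfile ((q₀ : ℝ) * ξ / M * q₁ * q₂)) q₁ q₂ := by
  beta_reduce
  rw [map_mul, map_mul, conj_pieceLo, conj_pieceHi, conj_alphaProfile]

/-- **`G_{XY}(δ₁𝐝, δ₂𝐜) = g_{XY}(𝐜,𝐝,𝐧,𝐫,𝐬)` on the plateau.** [cite: Drappeau2017, §5.5 p. 20–21] -/
theorem G_eq_drWeight_HL {S Y ξ M N : ℝ} (hN : 0 < N) {a₁ a₂ : ℤ} (ha₂ : a₂ ≠ 0) {q₀ n₀ δ₁ δ₂ : ℕ}
    (hn₀ : 0 < n₀) (hδ₁ : 0 < δ₁) (hδ₂ : 0 < δ₂) (σ : ℤ) {c d n₁ n₂ : ℕ}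
    (hn₁ : n₀ * n₁ ∈ BFI.dyadic N) (hn₂ : n₀ * n₂ ∈ BFI.dyadic N) (h : ℤ) {k : ℕ}
    (hlo : (((2 ^ k : ℕ) : ℕ) : ℤ) ≤ nVar σ a₁ a₂ q₀ h n₁ n₂)
    (hhi : nVar σ a₁ a₂ q₀ h n₁ n₂ < (((2 ^ (k + 1) : ℕ) : ℕ) : ℤ)) :
    (fun q₁ q₂ : ℕ => pieceHi S Y q₀ q₁ * pieceLo S Y q₀ q₂ *
          alphaProfile ((q₀ : ℝ) * ξ / M * q₁ * q₂)) (δ₁ * d) (δ₂ * c) =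
      (drWeight (pieceLo S Y ((q₀ : ℝ) * δ₂)) (pieceHi S Y ((q₀ : ℝ) * δ₁))
          ((q₀ : ℝ) * ξ / M * δ₁ * δ₂) ((2 : ℝ) ^ k) ((a₂.natAbs : ℝ) * δ₁ * N) ((δ₂ : ℝ) * N / n₀)) c d (nVar σ a₁ a₂ q₀ h n₁ n₂).toNat ((a₂.natAbs * n₀ * δ₁ * n₂ : ℕ) : ℝ) ((δ₂ * n₁ : ℕ) : ℝ) := by
  beta_reduce
  unfold drWeight
  -- the plateaus are `1`
  have h0 : 0 ≤ nVar σ a₁ a₂ q₀ h n₁ n₂ := le_trans (by positivity) hlo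
  have hNc : (((nVar σ a₁ a₂ q₀ h n₁ n₂).toNat : ℕ) : ℝ) = ((nVar σ a₁ a₂ q₀ h n₁ n₂ : ℤ) : ℝ) := by
    rw [show (((nVar σ a₁ a₂ q₀ h n₁ n₂).toNat : ℕ) : ℝ) =
      (((nVar σ a₁ a₂ q₀ h n₁ n₂).toNat : ℤ) : ℝ) by norm_cast, Int.toNat_of_nonneg h0]
  have hp1 : plateau ((2 : ℝ) ^ k) (((nVar σ a₁ a₂ q₀ h n₁ n₂).toNat : ℕ) : ℝ) = 1 := by
    rw [hNc]
    refine plateau_eq_one (by positivity) ?_ ?_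
    · have : ((2 : ℤ) ^ k : ℤ) ≤ nVar σ a₁ a₂ q₀ h n₁ n₂ := by exact_mod_cast hlo
      exact_mod_cast this
    · have : nVar σ a₁ a₂ q₀ h n₁ n₂ ≤ 2 * (2 : ℤ) ^ k := by
        have := hhi; push_cast at this; rw [pow_succ] at this; linarith
      exact_mod_cast this
  have hNr := (BFI.mem_dyadic hN.le).1 hn₁
  have hNr2 := (BFI.mem_dyadic hN.le).1 hn₂
  push_cast at hNr hNr2
  have har : (0 : ℝ) < a₂.natAbs := by exact_mod_cast Int.natAbs_pos.2 ha₂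
  have hδ₁r : (0 : ℝ) < δ₁ := by exact_mod_cast hδ₁
  have hδ₂r : (0 : ℝ) < δ₂ := by exact_mod_cast hδ₂
  have hn₀r : (0 : ℝ) < n₀ := by exact_mod_cast hn₀
  have hp2 : plateau ((a₂.natAbs : ℝ) * δ₁ * N) ((a₂.natAbs * n₀ * δ₁ * n₂ : ℕ) : ℝ) = 1 := by
    refine plateau_eq_one (by positivity) ?_ ?_
    · push_cast; nlinarith [mul_pos har hδ₁r, hNr2.1]
    · push_cast; nlinarith [mul_pos har hδ₁r, hNr2.2]
  have hp3 : plateau ((δ₂ : ℝ) * N / n₀) ((δ₂ * n₁ : ℕ) : ℝ) = 1 := by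
    refine plateau_eq_one (by positivity) ?_ ?_
    · push_cast; rw [div_le_iff₀ hn₀r]; nlinarith [hNr.1]
    · push_cast; rw [show 2 * ((δ₂ : ℝ) * N / n₀) = 2 * ((δ₂ : ℝ) * N) / n₀ by ring, le_div_iff₀ hn₀r]
      nlinarith [hNr.2]
  rw [hp1, hp2, hp3, mul_one, mul_one, mul_one]
  push_cast
  rw [pieceHi_mul_arg, pieceLo_mul_arg]
  rw [show (q₀ : ℝ) * ξ / M * δ₁ * δ₂ * c * d = (q₀ : ℝ) * ξ / M * ((δ₁ : ℝ) * d) * ((δ₂ : ℝ) * c) by ring]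
  ring

/-- **Support of `g_{XY}`**: ranges of `𝐜, 𝐝` and membership of the moduli in `mRange`.
[cite: Drappeau2017, §5.5 p. 20–21] -/
theorem drWeight_support_HL {S Y ξ M N : ℝ} (hY : 0 < Y) (hYS : Y ≤ S / 4) (hN : 0 < N)
    {a₂ : ℤ} (ha₂ : a₂ ≠ 0) {q₀ n₀ δ₁ δ₂ : ℕ} (hq₀ : 0 < q₀) (hn₀ : 0 < n₀) (hδ₁ : 0 < δ₁)
    (hδ₂ : 0 < δ₂) (k : ℕ) (c d : ℕ) (n r s : ℝ)
    (h : (drWeight (pieceLo S Y ((q₀ : ℝ) * δ₂)) (pieceHi S Y ((q₀ : ℝ) * δ₁))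
          ((q₀ : ℝ) * ξ / M * δ₁ * δ₂) ((2 : ℝ) ^ k) ((a₂.natAbs : ℝ) * δ₁ * N) ((δ₂ : ℝ) * N / n₀)) c d n r s ≠ 0) :
    (1 ≤ c ∧ c ≤ ⌊2 * (29 / 40 * S / ((q₀ : ℝ) * δ₂))⌋₊ ∧ 1 ≤ d ∧ d ≤ ⌊2 * (9 / 8 * S / ((q₀ : ℝ) * δ₁))⌋₊) ∧
      q₀ * (δ₂ * c) ∈ BFI.mRange S Y ∧ q₀ * (δ₁ * d) ∈ BFI.mRange S Y := by
  have hS : 0 < S := by linarith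
  have hq₀r : (0 : ℝ) < q₀ := by exact_mod_cast hq₀
  have hδ₁r : (0 : ℝ) < δ₁ := by exact_mod_cast hδ₁
  have hδ₂r : (0 : ℝ) < δ₂ := by exact_mod_cast hδ₂
  have har : (0 : ℝ) < a₂.natAbs := by exact_mod_cast Int.natAbs_pos.2 ha₂
  have hn₀r : (0 : ℝ) < n₀ := by exact_mod_cast hn₀
  have hsupp := drWeight_ne_zero (fun t ht => pieceLo_ne_zero hY hYS (by positivity) ht)
    (fun t ht => pieceHi_ne_zero hY hYS (by positivity) ht) ((q₀ : ℝ) * ξ / M * δ₁ * δ₂)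
    (Mn := (2 : ℝ) ^ k) (R := (a₂.natAbs : ℝ) * δ₁ * N) (S' := (δ₂ : ℝ) * N / n₀)
    (by positivity) (by positivity) (by positivity) h
  obtain ⟨hc1, hc2, hd1, hd2, -, -, -⟩ := hsupp
  -- the first two factors do not vanish
  unfold drWeight at h
  have hA := left_ne_zero_of_mul (left_ne_zero_of_mul (left_ne_zero_of_mul
    (left_ne_zero_of_mul (left_ne_zero_of_mul h))))
  have hB := right_ne_zero_of_mul (left_ne_zero_of_mul (left_ne_zero_of_mul
    (left_ne_zero_of_mul (left_ne_zero_of_mul h))))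
  have hCpos : 0 < (29 / 40 * S / ((q₀ : ℝ) * δ₂)) := by positivity
  have hDpos : 0 < (9 / 8 * S / ((q₀ : ℝ) * δ₁)) := by positivity
  refine ⟨⟨?_, Nat.le_floor hc2, ?_, Nat.le_floor hd2⟩,
    mem_mRange_of_gammaDil_ne_zero hY hS.le (gammaDil_ne_zero_of_pieceLo hA),
    mem_mRange_of_gammaDil_ne_zero hY hS.le (gammaDil_ne_zero_of_pieceHi hB)⟩
  · have : (0 : ℝ) < c := hCpos.trans hc1
    exact Nat.one_le_iff_ne_zero.2 fun h0 => by rw [h0] at this; simp at this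
  · have : (0 : ℝ) < d := hDpos.trans hd1
    exact Nat.one_le_iff_ne_zero.2 fun h0 => by rw [h0] at this; simp at this

/-- **`G_{XY}` is real.** [folklore] -/
theorem conj_G_HL (S Y ξ M : ℝ) (q₀ : ℕ) (q₁ q₂ : ℕ) :
    starRingEnd ℂ ((fun q₁ q₂ : ℕ => pieceHi S Y q₀ q₁ * pieceLo S Y q₀ q₂ *
          alphaProfile ((q₀ : ℝ) * ξ / M * q₁ * q₂)) q₁ q₂) = (fun q₁ q₂ : ℕ => pieceHi S Y q₀ q₁ * pieceLo S Y q₀ q₂ *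
          alphaProfile ((q₀ : ℝ) * ξ / M * q₁ * q₂)) q₁ q₂ := by
  beta_reduce
  rw [map_mul, map_mul, conj_pieceHi, conj_pieceLo, conj_alphaProfile]

/-- **`G_{XY}(δ₁𝐝, δ₂𝐜) = g_{XY}(𝐜,𝐝,𝐧,𝐫,𝐬)` on the plateau.** [cite: Drappeau2017, §5.5 p. 20–21] -/
theorem G_eq_drWeight_HH {S Y ξ M N : ℝ} (hN : 0 < N) {a₁ a₂ : ℤ} (ha₂ : a₂ ≠ 0) {q₀ n₀ δ₁ δ₂ : ℕ}
    (hn₀ : 0 < n₀) (hδ₁ : 0 < δ₁) (hδ₂ : 0 < δ₂) (σ : ℤ) {c d n₁ n₂ : ℕ}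
    (hn₁ : n₀ * n₁ ∈ BFI.dyadic N) (hn₂ : n₀ * n₂ ∈ BFI.dyadic N) (h : ℤ) {k : ℕ}
    (hlo : (((2 ^ k : ℕ) : ℕ) : ℤ) ≤ nVar σ a₁ a₂ q₀ h n₁ n₂)
    (hhi : nVar σ a₁ a₂ q₀ h n₁ n₂ < (((2 ^ (k + 1) : ℕ) : ℕ) : ℤ)) :
    (fun q₁ q₂ : ℕ => pieceHi S Y q₀ q₁ * pieceHi S Y q₀ q₂ *
          alphaProfile ((q₀ : ℝ) * ξ / M * q₁ * q₂)) (δ₁ * d) (δ₂ * c) =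
      (drWeight (pieceHi S Y ((q₀ : ℝ) * δ₂)) (pieceHi S Y ((q₀ : ℝ) * δ₁))
          ((q₀ : ℝ) * ξ / M * δ₁ * δ₂) ((2 : ℝ) ^ k) ((a₂.natAbs : ℝ) * δ₁ * N) ((δ₂ : ℝ) * N / n₀)) c d (nVar σ a₁ a₂ q₀ h n₁ n₂).toNat ((a₂.natAbs * n₀ * δ₁ * n₂ : ℕ) : ℝ) ((δ₂ * n₁ : ℕ) : ℝ) := by
  beta_reduce
  unfold drWeight
  -- the plateaus are `1`
  have h0 : 0 ≤ nVar σ a₁ a₂ q₀ h n₁ n₂ := le_trans (by positivity) hlo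
  have hNc : (((nVar σ a₁ a₂ q₀ h n₁ n₂).toNat : ℕ) : ℝ) = ((nVar σ a₁ a₂ q₀ h n₁ n₂ : ℤ) : ℝ) := by
    rw [show (((nVar σ a₁ a₂ q₀ h n₁ n₂).toNat : ℕ) : ℝ) =
      (((nVar σ a₁ a₂ q₀ h n₁ n₂).toNat : ℤ) : ℝ) by norm_cast, Int.toNat_of_nonneg h0]
  have hp1 : plateau ((2 : ℝ) ^ k) (((nVar σ a₁ a₂ q₀ h n₁ n₂).toNat : ℕ) : ℝ) = 1 := by
    rw [hNc]
    refine plateau_eq_one (by positivity) ?_ ?_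
    · have : ((2 : ℤ) ^ k : ℤ) ≤ nVar σ a₁ a₂ q₀ h n₁ n₂ := by exact_mod_cast hlo
      exact_mod_cast this
    · have : nVar σ a₁ a₂ q₀ h n₁ n₂ ≤ 2 * (2 : ℤ) ^ k := by
        have := hhi; push_cast at this; rw [pow_succ] at this; linarith
      exact_mod_cast this
  have hNr := (BFI.mem_dyadic hN.le).1 hn₁
  have hNr2 := (BFI.mem_dyadic hN.le).1 hn₂
  push_cast at hNr hNr2
  have har : (0 : ℝ) < a₂.natAbs := by exact_mod_cast Int.natAbs_pos.2 ha₂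
  have hδ₁r : (0 : ℝ) < δ₁ := by exact_mod_cast hδ₁
  have hδ₂r : (0 : ℝ) < δ₂ := by exact_mod_cast hδ₂
  have hn₀r : (0 : ℝ) < n₀ := by exact_mod_cast hn₀
  have hp2 : plateau ((a₂.natAbs : ℝ) * δ₁ * N) ((a₂.natAbs * n₀ * δ₁ * n₂ : ℕ) : ℝ) = 1 := by
    refine plateau_eq_one (by positivity) ?_ ?_
    · push_cast; nlinarith [mul_pos har hδ₁r, hNr2.1]
    · push_cast; nlinarith [mul_pos har hδ₁r, hNr2.2]
  have hp3 : plateau ((δ₂ : ℝ) * N / n₀) ((δ₂ * n₁ : ℕ) : ℝ) = 1 := by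
    refine plateau_eq_one (by positivity) ?_ ?_
    · push_cast; rw [div_le_iff₀ hn₀r]; nlinarith [hNr.1]
    · push_cast; rw [show 2 * ((δ₂ : ℝ) * N / n₀) = 2 * ((δ₂ : ℝ) * N) / n₀ by ring, le_div_iff₀ hn₀r]
      nlinarith [hNr.2]
  rw [hp1, hp2, hp3, mul_one, mul_one, mul_one]
  push_cast
  rw [pieceHi_mul_arg, pieceHi_mul_arg]
  rw [show (q₀ : ℝ) * ξ / M * δ₁ * δ₂ * c * d = (q₀ : ℝ) * ξ / M * ((δ₁ : ℝ) * d) * ((δ₂ : ℝ) * c) by ring]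
  ring

/-- **Support of `g_{XY}`**: ranges of `𝐜, 𝐝` and membership of the moduli in `mRange`.
[cite: Drappeau2017, §5.5 p. 20–21] -/
theorem drWeight_support_HH {S Y ξ M N : ℝ} (hY : 0 < Y) (hYS : Y ≤ S / 4) (hN : 0 < N)
    {a₂ : ℤ} (ha₂ : a₂ ≠ 0) {q₀ n₀ δ₁ δ₂ : ℕ} (hq₀ : 0 < q₀) (hn₀ : 0 < n₀) (hδ₁ : 0 < δ₁)
    (hδ₂ : 0 < δ₂) (k : ℕ) (c d : ℕ) (n r s : ℝ)
    (h : (drWeight (pieceHi S Y ((q₀ : ℝ) * δ₂)) (pieceHi S Y ((q₀ : ℝ) * δ₁))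
          ((q₀ : ℝ) * ξ / M * δ₁ * δ₂) ((2 : ℝ) ^ k) ((a₂.natAbs : ℝ) * δ₁ * N) ((δ₂ : ℝ) * N / n₀)) c d n r s ≠ 0) :
    (1 ≤ c ∧ c ≤ ⌊2 * (9 / 8 * S / ((q₀ : ℝ) * δ₂))⌋₊ ∧ 1 ≤ d ∧ d ≤ ⌊2 * (9 / 8 * S / ((q₀ : ℝ) * δ₁))⌋₊) ∧
      q₀ * (δ₂ * c) ∈ BFI.mRange S Y ∧ q₀ * (δ₁ * d) ∈ BFI.mRange S Y := by
  have hS : 0 < S := by linarith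
  have hq₀r : (0 : ℝ) < q₀ := by exact_mod_cast hq₀
  have hδ₁r : (0 : ℝ) < δ₁ := by exact_mod_cast hδ₁
  have hδ₂r : (0 : ℝ) < δ₂ := by exact_mod_cast hδ₂
  have har : (0 : ℝ) < a₂.natAbs := by exact_mod_cast Int.natAbs_pos.2 ha₂
  have hn₀r : (0 : ℝ) < n₀ := by exact_mod_cast hn₀
  have hsupp := drWeight_ne_zero (fun t ht => pieceHi_ne_zero hY hYS (by positivity) ht)
    (fun t ht => pieceHi_ne_zero hY hYS (by positivity) ht) ((q₀ : ℝ) * ξ / M * δ₁ * δ₂)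
    (Mn := (2 : ℝ) ^ k) (R := (a₂.natAbs : ℝ) * δ₁ * N) (S' := (δ₂ : ℝ) * N / n₀)
    (by positivity) (by positivity) (by positivity) h
  obtain ⟨hc1, hc2, hd1, hd2, -, -, -⟩ := hsupp
  -- the first two factors do not vanish
  unfold drWeight at h
  have hA := left_ne_zero_of_mul (left_ne_zero_of_mul (left_ne_zero_of_mul
    (left_ne_zero_of_mul (left_ne_zero_of_mul h))))
  have hB := right_ne_zero_of_mul (left_ne_zero_of_mul (left_ne_zero_of_mul
    (left_ne_zero_of_mul (left_ne_zero_of_mul h))))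
  have hCpos : 0 < (9 / 8 * S / ((q₀ : ℝ) * δ₂)) := by positivity
  have hDpos : 0 < (9 / 8 * S / ((q₀ : ℝ) * δ₁)) := by positivity
  refine ⟨⟨?_, Nat.le_floor hc2, ?_, Nat.le_floor hd2⟩,
    mem_mRange_of_gammaDil_ne_zero hY hS.le (gammaDil_ne_zero_of_pieceHi hA),
    mem_mRange_of_gammaDil_ne_zero hY hS.le (gammaDil_ne_zero_of_pieceHi hB)⟩
  · have : (0 : ℝ) < c := hCpos.trans hc1
    exact Nat.one_le_iff_ne_zero.2 fun h0 => by rw [h0] at this; simp at this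
  · have : (0 : ℝ) < d := hDpos.trans hd1
    exact Nat.one_le_iff_ne_zero.2 fun h0 => by rw [h0] at this; simp at this

/-- **`G_{XY}` is real.** [folklore] -/
theorem conj_G_HH (S Y ξ M : ℝ) (q₀ : ℕ) (q₁ q₂ : ℕ) :
    starRingEnd ℂ ((fun q₁ q₂ : ℕ => pieceHi S Y q₀ q₁ * pieceHi S Y q₀ q₂ *
          alphaProfile ((q₀ : ℝ) * ξ / M * q₁ * q₂)) q₁ q₂) = (fun q₁ q₂ : ℕ => pieceHi S Y q₀ q₁ * pieceHi S Y q₀ q₂ *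
          alphaProfile ((q₀ : ℝ) * ξ / M * q₁ * q₂)) q₁ q₂ := by
  beta_reduce
  rw [map_mul, map_mul, conj_pieceHi, conj_pieceHi, conj_alphaProfile]

end Drappeau2017

end Literature.NumberTheory.Sieve

end
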